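import Summits.Schanuel.Schanuel.Theorems.RootDecomp1KHyperellipticSiegel04

/-!
# RootDecomp1KHyperellipticSiegel — lens 1, generation 62, NODE 23 «HYPERELLIPTIC SIEGEL ON THE K-LINE — the dominant live sector» (Siegel's theorem for y² = f(x), f separable of degree ≥ 3, over any number field — AEC IX.4.3 — PROVED from the tree's unit equation and cubic case; the engine on DOMINANT x-degree-2 pairs c₂x² + c₁x + c₀ (deg c₁, deg c₂ < deg c₀) with separable x-discriminant of degree ≥ 3 ⇒ SiegelClause / LevelFinite / ThinFibreAt ∀ m₀ / BddLevelEmpty, intrinsically the class DomHyper P; the genus-two family M j := x² + 3Y·x + (Y⁵ + 9jY + 9j + 3) decided hypothesis-free ∀ j ∈ ℤ; the territory M_territory incl. 2-adic liveness by size at m₀ = 2; CLAIM L2879, PRICE L2882, K-R54) — continuation (RootDecomp1KHyperellipticSiegel05): §T part 2: the anchor point (1, −1) at level 1 (¬OddEmptyAt / ¬TangentEmptyAt ∀ ℓ by node 21's names), real liveness at every level, (T-2) 2-adic liveness by size (den_pow_five_le_M, den_pow_lt_M, not_thin_ineq_two_M) and the corollary thinFibreAt_two_iff_levelFinite_M,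 the territory theorem M_territory (42 conjuncts by tree FQNs), the pinned subfamily M′ j := M (77j + 67) with M'_zero / M'_one / M'_territory (section Territory re-opened)

(lens-1 g62 NODE 23 «HYPERELLIPTIC SIEGEL ON THE K-LINE — the DOMINANT LIVE SECTOR» L2903: HOME kernel K = HOME/decomp-schanuel-lens-1/g62/lean/HyperellipticSiegel.lean sha256 f4b0f073…, 1239 l, 124 theorems + 8 defs, ONE namespace `Summit.Schanuel.Schanuel.Theorems.RootDecomp1KHyperellipticSiegel`, imports the tree port …RootDecomp1KSiegelGenusOne05 ONLY (the PROVED Literature modules Literature.NumberTheory.DiophantineGeometry.{SiegelCubicReduction, UnitEquationFinite, SIntegersFiniteExtension} and EllipticCurves.{KummerSelmerGroupFinite, TwoDescentParity} arrive transitively, BUILT; no …Proofs umbrella, no fact file); no private, no instance, no set_option, no notation, no sorry, no native_decide / decide; farm of record (lens): K rc 0 · 0 errors · 0 sorries, Probe rc 0 (211 `#print axioms` guards, standard triple), Ctrl0 rc 0, Ctrl rc 1 = 42 planted errors exactly; CLAIM L2879, crit g11 PRICE L2882 (PAYABLE THEOREM ×1 EX ANTE for (L)+(E)+(F)+(T)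 jointly under K-R53 (iii) prong 4; CHECKLIST K-g62 (1)–(11); RULE K-R54 PRE-ANNOUNCED), census LIVENESS-v24/v25/v26 (rows M 67 / M 144 / X3; keys hsE / galq / genus_torus of record L2882 / L2893 / L2897), crit g12 RULING L2893 (X3 = standing witness of the dominant-far sector), ADVANCE NOTICE L2901 (a) (engine generality DomZero 2), writer g32/g33 NOTES 14 / 1 / 2 / 4 (pre-kernel arithmetic incl. the real place; X3 certificate; DomHyper flips), critic VERDICT (crit g12): CLEARED — THEOREM ×1 for (L)+(E)+(F)+(T) JOINTLY, ONE credit (K-R53 (iii) prong 4), VERDICT L2907 (crit g12): CHECKLIST K-g62 (1)–(11) met item by item on the critic's own farm runs (K c679d0af… rc 0 · 0 errors · 0 sorries; Probe a3866a38… rc 0 with 211 `#print axioms` guards ⊆ the standard triple; Ctrl0 rc 0; Ctrl rc 1 = exactly the 42 planted errors; L_standalone rc 0 ⇒ §L uses nothing from the K-line); ERRATUM OF RECORD E1 = lens ADDENDUM 1 L2904 (memo only: (E) as typed = node 15's c₀-dominance `DomZero 2` reaches seven tabled LIVENESS rows — M 67, M 144 + the by-product rows contactC / highContactC / quinticP /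 RC2 / GC2 «reachable, not instantiated»); LABEL OF RECORD: literature KNOWN TOOL (Siegel 1926 / LeVeque 1964; AEC IX.4.3; B–G 5.2.1 for U) · tree-NEW PROVED THEOREM · problem-relative NEW LEVER on the K-line (the first genus-≥ 2 class decided; integral-point Siegel consumed directly); TALLY lens-1 ×20 + THEOREM ×22; RULE K-R54 FIXED ((i) toolkit ∪= integral-point Siegel in general = ×0-as-record after node 23; (ii) open territory at m₀ = 2 := K-R53 (ii) territory not reached by (i) ∪ K-R53 (i), two named sectors with standing witnesses W4 (non-dominant) and X3 (dominant-far); (iii) payable clause; (iv) unconditional part ∪= the node-23 tree names after the port); lens DONE L2909; PORT GO L2908 exactly as census STAGING NOTE 13 L2905 (five parts; the one pre-emptive privatisation accepted; chain import as staged). Port by census-1 gen 24 per NODE-g62.md §(11) as `RootDecomp1KHyperellipticSiegel01–05` (`--supports stmt-Schanuel-33364`; the item stays OPEN; no census credit): 01 = §L Siegel's theorem for y² = f(x) in full (sections Parity, Cofactor; `exists_numberField_forall_isSquare_of_even`; `finite_integer_sq_eq_of_unitEquation` with the tree's U-binder verbatim; `finite_integer_sq_eq` unconditional) — the ONLY part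 whose proofs touch Literature names, all CITED by name (`finite_unitEquation`, `finite_integer_sq_eq_cubic_of_unitEquation`, `exists_numberField_forall_mem_selmerGroup_isSquare`, `exists_finite_forall_mem_integer_algebraMap`, `IsDedekindDomain.mk_mem_selmerGroup_iff`, `setOf_valuation_ne_one_finite`, `setOf_one_lt_valuation_finite`), never restated; 02 = §E the engine on dominant x-degree-2 pairs (`pDisc`, `xDisc_xPolyP_two`, `sq_eq_aeval_pDisc`, `den_dvd_of_dyadic`, `badT`, `ordinate_mem_integer`, `fibrePoly_ne_zero`, `finite_ordinates_dom2` … `finite_pointed_levels_dom2`) + §E′ the intrinsic class (`DomHyper`, `domHyper_xPolyP_iff`, `thinFibreAt_of_domHyper`, `levelFinite_of_domHyper`, `siegelClause_of_domHyper`, `bddLevelEmpty_of_domHyper`, …) (section Engine); 03 = §F the family M j (`mQ`, `mC`, `M`, `mD`, `isEisensteinAt_mD`, `domHyper_M`, `levelFinite_M`, `thinFibreAt_M`, `bddLevelEmpty_M`, `siegelClause_M`, `finite_dyadicPoints_M`) (section Family); 04 = §T part 1 (numerology, shape refusals, `presentation_M`, rootless / decided / slope / local / Gauss refusals, `thinFibreAt_M_of_three_le`,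 `irreducible_xDisc_M`) (section Territory, to be continued); 05 = §T part 2 (the anchor (1, −1), odd/tangent-emptiness refusals, real roots, (T-2) `den_pow_five_le_M` / `den_pow_lt_M` / `not_thin_ineq_two_M`, `thinFibreAt_two_iff_levelFinite_M`, `M_territory`, `M'`, `M'_zero` / `M'_one`, `M'_territory`) (section Territory re-opened with K's own open-lines). Text = K VERBATIM (every declaration of K is documented by the lens; statements and proofs unchanged; the module docstring of K kept in part 01 below this provenance block).)
-/

noncomputable section

namespace Summit.Schanuel.Schanuel.Theorems.RootDecomp1KHyperellipticSiegel

open Polynomial IsDedekindDomain NumberField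
open scoped Classical WithZero
open Literature.NumberTheory.DiophantineGeometry (finite_integer_sq_eq_cubic_of_unitEquation finite_unitEquation
  exists_numberField_forall_mem_selmerGroup_isSquare exists_finite_forall_mem_integer_algebraMap)
open IsDedekindDomain.HeightOneSpectrum (setOf_valuation_ne_one_finite setOf_one_lt_valuation_finite)

/-! (section Territory, continued from part 04 — re-opened with K's own open-lines) -/

section Territory

open LiouvilleNumber
open scoped Nat
open Summit.Schanuel.Schanuel.Theorems.RootDecomp1KDegreeLadder
open Summit.Schanuel.Schanuel.Theorems.RootDecomp1KXLinear
open Summit.Schanuel.Schanuel.Theorems.RootDecomp1KXTop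
open Summit.Schanuel.Schanuel.Theorems.RootDecomp1KXAll
open Summit.Schanuel.Schanuel.Theorems.RootDecomp1KLevelFinite
open Summit.Schanuel.Schanuel.Theorems.RootDecomp1KThueMahler
open Summit.Schanuel.Schanuel.Theorems.RootDecomp1KLocalExponent
open Summit.Schanuel.Schanuel.Theorems.RootDecomp1KIntegrality (DomZero GaussAt gaussAt_xPolyP_iff thinFibreAt_of_gaussAt)
open Summit.Schanuel.Schanuel.Theorems.RootDecomp1KSubspaceBranch (SepTopAt)
open Summit.Schanuel.Schanuel.Theorems.RootDecomp1KHeightGrading (BddLevelEmpty bddLevelEmpty_iff_levelFinite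
  HeightDecidedAt)
open Summit.Schanuel.Schanuel.Theorems.RootDecomp1KDescent
open Summit.Schanuel.Schanuel.Theorems.RootDecomp1KCubicDescent
open Summit.Schanuel.Schanuel.Theorems.RootDecomp1KOddEmpty
open Summit.Schanuel.Schanuel.Theorems.RootDecomp1KSiegelGenusOne (SW sC sC_two sC_of_gt S')
open Summit.Schanuel.Schanuel.Theorems.RootDecomp1KTwoBaseCell (psNumer)

/-- **THE ANCHOR POINT `(1, −1) ∈ M j` for EVERY `j`** (`−1 − 9j + 9j + 3 − 3 + 1 = 0`) — an INTEGRAL abscissa, indeed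
the LEVEL-1 abscissa `s₁ = 1`: the member is LOCALLY LIVE at every place and level `1` carries a rational point. -/
theorem bev_M_anchor (j : ℤ) : bev (M j) (((1 : ℤ) : ℚ) : ℝ) (((-1 : ℚ)) : ℝ) = 0 := by
  rw [bev_M]; push_cast; ring
/-- `∂/∂x (M j)(x, y) = 2x + 3y`, typed `HasDerivAt`. -/
theorem hasDerivAt_bev_M (j : ℤ) (x y : ℝ) : HasDerivAt (fun x' => bev (M j) x' y) (2 * x + 3 * y) x := by
  have h : (fun x' => bev (M j) x' y) = fun x' => x' ^ 2 + (3 * y) * x' + (y ^ 5 + 9 * j * y + (9 * j + 3)) := by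
    funext x'; rw [bev_M]; ring
  rw [h]
  have hp : HasDerivAt (fun x' : ℝ => x' ^ 2) (2 * x) x := by simpa using hasDerivAt_pow 2 x
  exact ((hp.add ((hasDerivAt_id' x).const_mul _)).add_const _).congr_deriv (by ring)
/-- **THE ANCHOR POINT IS SMOOTH**: `∂P/∂x (1, −1) = −1 ≠ 0`. -/
theorem hasDerivAt_M_anchor (j : ℤ) :
    HasDerivAt (fun x => bev (M j) x (((-1 : ℚ)) : ℝ)) (-1) (((1 : ℤ) : ℚ) : ℝ) := by
  have h := hasDerivAt_bev_M j (((1 : ℤ) : ℚ) : ℝ) (((-1 : ℚ)) : ℝ)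
  have h3 : (-1 : ℝ) = 2 * (((1 : ℤ) : ℚ) : ℝ) + 3 * (((-1 : ℚ)) : ℝ) := by push_cast; ring
  rw [h3]; exact h
/-- node 21's general engine `OddEmptyAt ℓ` is REFUSED at EVERY `ℓ` (the anchor point has integral abscissa). -/
theorem not_oddEmptyAt_M (j : ℤ) (ℓ : ℕ) : ¬ OddEmptyAt ℓ (M j) := by
  by_cases h1 : ℓ = 1
  · subst h1; rintro ⟨k, c, n, -, -, hprime, -⟩; exact Nat.not_prime_one hprime
  · exact not_oddEmptyAt_of_ratPoint ((1 : ℤ) : ℚ) (-1) (by simp [h1]) (bev_M_anchor j)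
/-- … and so is the W4-shape engine `TangentEmptyAt ℓ`. -/
theorem not_tangentEmptyAt_M (j : ℤ) (ℓ : ℕ) : ¬ TangentEmptyAt ℓ (M j) := by
  by_cases h1 : ℓ = 1
  · subst h1; rintro ⟨c, n, -, -, -, -, hprime, -⟩; exact Nat.not_prime_one hprime
  · exact not_tangentEmptyAt_of_ratPoint ((1 : ℤ) : ℚ) (-1) (by simp [h1]) (bev_M_anchor j)

/-- every real quintic `y⁵ + a·y + b` has a real root (IVT on `[−R, R]`, `R = 1 + |a| + |b|`). -/
theorem exists_root_quintic (a b : ℝ) : ∃ y : ℝ, y ^ 5 + a * y + b = 0 := by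
  set R : ℝ := 1 + |a| + |b| with hR
  have ha := abs_nonneg a
  have hb := abs_nonneg b
  have hR1 : 1 ≤ R := by rw [hR]; linarith
  have hR5 : R ^ 2 ≤ R ^ 5 := pow_le_pow_right₀ hR1 (by norm_num)
  have hRR : R ^ 2 = R + |a| * R + |b| * R := by rw [hR]; ring
  have haR : -(|a| * R) ≤ a * R ∧ a * R ≤ |a| * R :=
    ⟨by nlinarith [neg_abs_le a], by nlinarith [le_abs_self a]⟩
  have hbR : |b| ≤ |b| * R := by nlinarith
  have hb1 := le_abs_self b
  have hb2 := neg_abs_le b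
  have hcont : Continuous fun y : ℝ => y ^ 5 + a * y + b := by fun_prop
  have hneg : (-R) ^ 5 + a * (-R) + b ≤ 0 := by
    have : (-R) ^ 5 = -(R ^ 5) := by ring
    rw [this]; linarith [haR.1]
  have hpos : 0 ≤ R ^ 5 + a * R + b := by linarith [haR.1]
  obtain ⟨y, -, hy⟩ := intermediate_value_Icc (by linarith : -R ≤ R) hcont.continuousOn (Set.mem_Icc.mpr ⟨hneg, hpos⟩)
  exact ⟨y, hy⟩
/-- **`M j` IS REAL-LIVE AT EVERY REAL ABSCISSA** (odd `Y`-degree) … -/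
theorem exists_real_root_M (j : ℤ) (x : ℝ) : ∃ y : ℝ, bev (M j) x y = 0 := by
  obtain ⟨y, hy⟩ := exists_root_quintic (3 * x + 9 * j) (x ^ 2 + (9 * j + 3))
  exact ⟨y, by rw [bev_M]; linear_combination hy⟩
/-- **… in particular AT EVERY LEVEL: `∀ j N, ∃ r : ℝ, M j (s_N, r) = 0`.** -/
theorem M_real_live (j : ℤ) (N : ℕ) : ∃ r : ℝ, bev (M j) (partialSum 2 N) r = 0 := exists_real_root_M j _

/-- **(T-2) 2-ADIC LIVENESS BY SIZE, TYPED: at a level point `(s_N, r)` of `M j`, `den(r)⁵ ≤ 2^{2·N!}`** — the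
denominator of `r` is `2^e` (integrality under dominance: `den_dvd_of_dyadic`) with `5e ≤ 2·N!`: else the term
`2^{2·N!}·num(r)⁵` of the cleared equation is the UNIQUE one of least 2-adic order and `num(r)` would be even. -/
theorem den_pow_five_le_M (j : ℤ) (N : ℕ) {r : ℚ} (h : bev (M j) (partialSum 2 N) r = 0) :
    r.den ^ 5 ≤ 2 ^ (2 * N !) := by
  rw [← sQ_cast] at h
  have hq := ratEq_M j h
  obtain ⟨t, ht⟩ := isDyadic_sQ N
  have h3 : aeval r (C 3 * X : ℤ[X]) = 3 * r := by
    rw [map_mul, aeval_C, aeval_X, algebraMap_int_eq, eq_intCast, Int.cast_ofNat]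
  have hsum : ∑ i ∈ Finset.range (2 + 1), sQ N ^ i * aeval r (mC j i) = 0 := by
    simp only [Finset.sum_range_succ, Finset.sum_range_zero, pow_zero, one_mul, zero_add, pow_one, mC_zero, mC_one,
      mC_two, aeval_mQ, h3, map_one]
    linear_combination hq
  have hdvd := den_dvd_of_dyadic 2 (mC j) (domZero_mC j) (ne_zero_of_domZero (by norm_num) (domZero_mC j)) ht hsum
  rw [mC_zero, leadingCoeff_mQ, mul_one] at hdvd
  have hdvd' : r.den ∣ 2 ^ (2 * t) := by exact_mod_cast hdvd
  obtain ⟨e, -, he⟩ := (Nat.dvd_prime_pow Nat.prime_two).1 hdvd'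
  rw [he, ← pow_mul]
  refine Nat.pow_le_pow_right (by norm_num) ?_
  by_contra hlt
  push Not at hlt
  have he1 : 1 ≤ e := by omega
  have hn : (r.num : ℚ) = r * 2 ^ e := by
    have := Rat.mul_den_eq_num r
    rw [he] at this
    push_cast at this
    exact this.symm
  have hp : (psNumer 2 N : ℚ) = sQ N * 2 ^ N ! := by
    rw [sQ, div_mul_cancel₀]
    exact pow_ne_zero _ two_ne_zero
  -- the cleared equation in `ℤ`
  have key : (2 : ℤ) ^ (2 * N !) * r.num ^ 5 + 2 ^ (4 * e + 2 * N !) * (9 * j * r.num) +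
      2 ^ (5 * e + 2 * N !) * (9 * j + 3) + 2 ^ (4 * e + N !) * (3 * (psNumer 2 N : ℤ) * r.num) +
      2 ^ (5 * e) * (psNumer 2 N : ℤ) ^ 2 = 0 := by
    have hQ : (((2 : ℤ) ^ (2 * N !) * r.num ^ 5 + 2 ^ (4 * e + 2 * N !) * (9 * j * r.num) +
        2 ^ (5 * e + 2 * N !) * (9 * j + 3) + 2 ^ (4 * e + N !) * (3 * (psNumer 2 N : ℤ) * r.num) +
        2 ^ (5 * e) * (psNumer 2 N : ℤ) ^ 2 : ℤ) : ℚ) =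
        2 ^ (5 * e) * 2 ^ (2 * N !) * (r ^ 5 + 9 * j * r + (9 * j + 3) + sQ N * (3 * r) + sQ N ^ 2) := by
      push_cast
      rw [hn, hp]
      ring
    rw [hq, mul_zero] at hQ
    exact_mod_cast hQ
  -- every term but the first is divisible by `2^{2·N! + 1}` (`5e > 2·N!`, so `4e > N!`), hence so is the first
  have h1 : (2 : ℤ) ^ (2 * N ! + 1) ∣ 2 ^ (2 * N !) * r.num ^ 5 := by
    have d2 : (2 : ℤ) ^ (2 * N ! + 1) ∣ 2 ^ (4 * e + 2 * N !) * (9 * j * r.num) :=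
      (pow_dvd_pow 2 (by omega)).mul_right _
    have d3 : (2 : ℤ) ^ (2 * N ! + 1) ∣ 2 ^ (5 * e + 2 * N !) * (9 * j + 3) := (pow_dvd_pow 2 (by omega)).mul_right _
    have d4 : (2 : ℤ) ^ (2 * N ! + 1) ∣ 2 ^ (4 * e + N !) * (3 * (psNumer 2 N : ℤ) * r.num) :=
      (pow_dvd_pow 2 (by omega)).mul_right _
    have d5 : (2 : ℤ) ^ (2 * N ! + 1) ∣ 2 ^ (5 * e) * (psNumer 2 N : ℤ) ^ 2 := (pow_dvd_pow 2 (by omega)).mul_right _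
    have hre : (2 : ℤ) ^ (2 * N !) * r.num ^ 5 = -(2 ^ (4 * e + 2 * N !) * (9 * j * r.num) +
        2 ^ (5 * e + 2 * N !) * (9 * j + 3) + 2 ^ (4 * e + N !) * (3 * (psNumer 2 N : ℤ) * r.num) +
        2 ^ (5 * e) * (psNumer 2 N : ℤ) ^ 2) := by linear_combination key
    rw [hre]
    exact (((d2.add d3).add d4).add d5).neg_right
  rw [pow_succ, mul_dvd_mul_iff_left (pow_ne_zero _ two_ne_zero)] at h1
  have h2n : (2 : ℤ) ∣ r.num := Int.prime_two.dvd_of_dvd_pow h1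
  -- … contradicting `gcd(num r, den r) = 1` with `2 ∣ den r`
  have h2nat : 2 ∣ r.num.natAbs := by simpa using Int.natAbs_dvd_natAbs.mpr h2n
  have h2den : 2 ∣ r.den := by rw [he]; exact dvd_pow_self 2 (by omega)
  have h22 : Nat.Coprime 2 2 := (Nat.Coprime.coprime_dvd_left h2nat r.reduced).coprime_dvd_right h2den
  norm_num at h22

/-- **(T-2′) HENCE `den(r)^{2N} < 2^{(N+1)!}` AT EVERY LEVEL POINT** (`(den^{2N})⁵ ≤ 2^{4N·N!} < 2^{5(N+1)!}`): node
15's thin-fibre INEQUALITY at `m₀ = 2` (`C·2^{(N+1)!} < den(r)^{2N}`) FAILS at EVERY level point of EVERY `M j` —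
`M j` is 2-ADICALLY LIVE at the residual quality; only the EMPTINESS of the far levels (Siegel) decides it. -/
theorem den_pow_lt_M (j : ℤ) (N : ℕ) {r : ℚ} (h : bev (M j) (partialSum 2 N) r = 0) :
    (r.den : ℝ) ^ (2 * N) < 2 ^ (N + 1)! := by
  have h5 := den_pow_five_le_M j N h
  have hL := N.factorial_pos
  have key : (r.den ^ (2 * N)) ^ 5 < (2 ^ (N + 1)!) ^ 5 :=
    calc (r.den ^ (2 * N)) ^ 5 = (r.den ^ 5) ^ (2 * N) := by ring
      _ ≤ (2 ^ (2 * N !)) ^ (2 * N) := Nat.pow_le_pow_left h5 _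
      _ = 2 ^ (2 * N ! * (2 * N)) := by rw [← pow_mul]
      _ < 2 ^ ((N + 1)! * 5) := Nat.pow_lt_pow_right (by norm_num) (by rw [Nat.factorial_succ]; nlinarith)
      _ = (2 ^ (N + 1)!) ^ 5 := by rw [pow_mul]
  have hnat : r.den ^ (2 * N) < 2 ^ (N + 1)! := (Nat.pow_lt_pow_iff_left (by norm_num)).mp key
  exact_mod_cast hnat
/-- the thin-fibre inequality of quality `2` FAILS at every level point of `M j`, for every constant `C ≥ 1`. -/
theorem not_thin_ineq_two_M (j : ℤ) (N : ℕ) {r : ℚ} (h : bev (M j) (partialSum 2 N) r = 0) {C : ℝ} (hC : 1 ≤ C) :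
    ¬ C * 2 ^ (N + 1)! < (r.den : ℝ) ^ (2 * N) := by
  have h2 := den_pow_lt_M j N h
  have h3 : (2 : ℝ) ^ (N + 1)! ≤ C * 2 ^ (N + 1)! := le_mul_of_one_le_left (by positivity) hC
  intro h1; linarith
/-- **COROLLARY: ON `M j`, `ThinFibreAt 2` IS LEVEL-FINITENESS** — the quality-2 clause can only hold VACUOUSLY
(beyond the last pointed level); both sides HOLD (`levelFinite_M`), but no `p`-adic / size argument of the record can be
the reason. -/
theorem thinFibreAt_two_iff_levelFinite_M (j : ℤ) : ThinFibreAt 2 (M j) ↔ LevelFinite (M j) := by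
  refine ⟨fun hT C => ?_, fun hL => thinFibreAt_of_levelFinite hL 2⟩
  obtain ⟨N₀, hN₀⟩ := hT (max C 1)
  refine (Set.finite_lt_nat N₀).subset ?_
  rintro N ⟨r, hrC, hroot, hnd⟩
  by_contra hN
  simp only [Set.mem_setOf_eq, not_lt] at hN
  exact not_thin_ineq_two_M j N hroot (le_max_right C 1) (hN₀ N hN r (hrC.trans (le_max_left _ _)) hroot hnd)

/-- **THE INFINITE CLASS `M j`, `j ∈ ℤ`, OF OPEN-TERRITORY PAIRS DECIDED HYPOTHESIS-FREE BY SIEGEL'S THEOREM FOR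
HYPERELLIPTIC CURVES (§L, a theorem of this file) — TERRITORY, CERTIFICATES AND THEOREMS, uniformly in `j`, by tree
names:** `x`-degree 2, `Y`-degree 5 (odd), CONSTANT top `1`, `eTop = 5`, `thinThreshold = 6`, outside node 12's height
shape, not x-linear / `XLinearLt` / `XLinTM` / two-term / norm shape / `CB` / `VW` / `SW` / `dsP`, `¬ RootlessTop e`
(`e ≤ 4`) ∧ `RootlessTop 5`, `¬ DecidedAt 2`, `¬ LocalAt 2`, `¬ GaussAt 2` ∧ `GaussAt 3`, `¬ HeightDecidedAt 2`,
`¬ SepTopAt 2`; `DomHyper`; `Δ_x = Δ_j` a ℚ-IRREDUCIBLE QUINTIC (genus two); LOCALLY LIVE: the smooth anchor point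
`(1, −1)` (level `1`), `¬ OddEmptyAt ℓ`, `¬ TangentEmptyAt ℓ` at every `ℓ`; REAL-LIVE at every level; 2-ADICALLY LIVE at
quality 2 ((T-2), (T-2′)); `ThinFibreAt 2 ↔ LevelFinite`; and the THEOREMS: `SiegelClause`, finitely many pointed
levels / level ordinates / dyadic points, `LevelFinite`, `BddLevelEmpty`, `ThinFibreAt m₀` for EVERY `m₀`. -/
theorem M_territory (j : ℤ) :
    xdeg (M j) = 2 ∧ (M j).natDegree = 5 ∧ topX (M j) = 1 ∧ eTop (M j) = 5 ∧ thinThreshold (M j) = 6 ∧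
      ¬ (M j).natDegree < 2 * xdeg (M j) ∧
      ¬ XLinearLt (M j) ∧ ¬ XLinTM (M j) ∧ (∀ A B, M j ≠ xLinP A B) ∧ (∀ k B A, M j ≠ twoTermP k B A) ∧
      (∀ g q n D, M j ≠ normShapeCurve g q n D) ∧ (∀ h₁ h₀ l₁ l₀, M j ≠ CB h₁ h₀ l₁ l₀) ∧ (∀ l, M j ≠ VW l) ∧
      (∀ e, M j ≠ SW e) ∧ (∀ Q A, M j ≠ dsP Q A) ∧
      (∀ e, e ≤ 4 → ¬ RootlessTop e (M j)) ∧ RootlessTop 5 (M j) ∧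
      ¬ DecidedAt 2 (M j) ∧ ¬ LocalAt 2 (M j) ∧ ¬ GaussAt 2 (M j) ∧ GaussAt 3 (M j) ∧
      ¬ HeightDecidedAt 2 (M j) ∧ ¬ SepTopAt 2 (M j) ∧
      DomHyper (M j) ∧ xDisc (M j) = mD j ∧ Irreducible ((xDisc (M j)).map (Int.castRingHom ℚ)) ∧
      (xDisc (M j)).natDegree = 5 ∧
      bev (M j) (((1 : ℤ) : ℚ) : ℝ) (((-1 : ℚ)) : ℝ) = 0 ∧
      HasDerivAt (fun x => bev (M j) x (((-1 : ℚ)) : ℝ)) (-1) (((1 : ℤ) : ℚ) : ℝ) ∧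
      (∀ ℓ, ¬ OddEmptyAt ℓ (M j)) ∧ (∀ ℓ, ¬ TangentEmptyAt ℓ (M j)) ∧
      (∀ N, ∃ r : ℝ, bev (M j) (partialSum 2 N) r = 0) ∧
      (∀ N (r : ℚ), bev (M j) (partialSum 2 N) r = 0 → r.den ^ 5 ≤ 2 ^ (2 * N !)) ∧
      (∀ N (r : ℚ), bev (M j) (partialSum 2 N) r = 0 → (r.den : ℝ) ^ (2 * N) < 2 ^ (N + 1)!) ∧
      (ThinFibreAt 2 (M j) ↔ LevelFinite (M j)) ∧
      SiegelClause (M j) ∧ {N : ℕ | ∃ r : ℚ, bev (M j) (partialSum 2 N) r = 0}.Finite ∧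
      {r : ℚ | ∃ N : ℕ, bev (M j) (partialSum 2 N) r = 0}.Finite ∧
      {p : ℚ × ℚ | IsDyadic p.1 ∧ bev (M j) p.1 p.2 = 0}.Finite ∧
      LevelFinite (M j) ∧ BddLevelEmpty (M j) ∧ (∀ m₀, ThinFibreAt m₀ (M j)) :=
  ⟨xdeg_M j, natDegree_M j, topX_M j, eTop_M j, thinThreshold_M j, not_natDegree_M_lt j, not_xLinearLt_M j,
    not_xLinTM_M j, M_ne_xLinP j, M_ne_twoTermP j, M_ne_normShapeCurve j, M_ne_CB j, M_ne_VW j, M_ne_SW j, M_ne_dsP j,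
    fun _ he => not_rootlessTop_M j he, rootlessTop_five_M j, not_decidedAt_M j (by norm_num), not_localAt_M j le_rfl,
    not_gaussAt_M j le_rfl, gaussAt_M j le_rfl, not_heightDecidedAt_M j le_rfl, not_sepTopAt_M j (by norm_num),
    domHyper_M j, xDisc_M j, (irreducible_xDisc_M j).1, (irreducible_xDisc_M j).2, bev_M_anchor j, hasDerivAt_M_anchor j,
    not_oddEmptyAt_M j, not_tangentEmptyAt_M j, M_real_live j, fun N _ h => den_pow_five_le_M j N h,
    fun N _ h => den_pow_lt_M j N h, thinFibreAt_two_iff_levelFinite_M j, siegelClause_M j, finite_pointed_levels_M j,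
    finite_ordinates_M j, finite_dyadicPoints_M j, levelFinite_M j, bddLevelEmpty_M j, thinFibreAt_M j⟩

/-- [datum] **THE PINNED SUBFAMILY `M′ j := M (77j + 67)`** (`77 = 7·11`, `67 ≡ 4 (mod 7)`, `67 ≡ 1 (mod 11)`: the
residues the INSTRUMENT READINGS of NODE-g62 §(10) use — `#J(𝔽₇) = 37`, `Δ mod 11` of type `(2)(3)` hence
`Gal(Δ) = S₅`; those readings are CITED, not typed). -/
def M' (j : ℤ) : ℤ[X][X] := M (77 * j + 67)
/-- `M′ 0 = M 67 = x² + 3Y·x + (Y⁵ + 603Y + 606)` — census row «node23 M 67» (LIVENESS-v24). -/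
theorem M'_zero : M' 0 = M 67 := by rw [M']; norm_num
/-- `M′ 1 = M 144` — census row «node23 M 144». -/
theorem M'_one : M' 1 = M 144 := by rw [M']; norm_num
/-- **`M'_territory`**: the territory theorem for the pinned subfamily (an instance of `M_territory`). -/
theorem M'_territory (j : ℤ) :
    xdeg (M' j) = 2 ∧ (M' j).natDegree = 5 ∧ topX (M' j) = 1 ∧ eTop (M' j) = 5 ∧ thinThreshold (M' j) = 6 ∧
      ¬ (M' j).natDegree < 2 * xdeg (M' j) ∧
      ¬ XLinearLt (M' j) ∧ ¬ XLinTM (M' j) ∧ (∀ A B, M' j ≠ xLinP A B) ∧ (∀ k B A, M' j ≠ twoTermP k B A) ∧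
      (∀ g q n D, M' j ≠ normShapeCurve g q n D) ∧ (∀ h₁ h₀ l₁ l₀, M' j ≠ CB h₁ h₀ l₁ l₀) ∧ (∀ l, M' j ≠ VW l) ∧
      (∀ e, M' j ≠ SW e) ∧ (∀ Q A, M' j ≠ dsP Q A) ∧
      (∀ e, e ≤ 4 → ¬ RootlessTop e (M' j)) ∧ RootlessTop 5 (M' j) ∧
      ¬ DecidedAt 2 (M' j) ∧ ¬ LocalAt 2 (M' j) ∧ ¬ GaussAt 2 (M' j) ∧ GaussAt 3 (M' j) ∧
      ¬ HeightDecidedAt 2 (M' j) ∧ ¬ SepTopAt 2 (M' j) ∧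
      DomHyper (M' j) ∧ xDisc (M' j) = mD (77 * j + 67) ∧ Irreducible ((xDisc (M' j)).map (Int.castRingHom ℚ)) ∧
      (xDisc (M' j)).natDegree = 5 ∧
      bev (M' j) (((1 : ℤ) : ℚ) : ℝ) (((-1 : ℚ)) : ℝ) = 0 ∧
      HasDerivAt (fun x => bev (M' j) x (((-1 : ℚ)) : ℝ)) (-1) (((1 : ℤ) : ℚ) : ℝ) ∧
      (∀ ℓ, ¬ OddEmptyAt ℓ (M' j)) ∧ (∀ ℓ, ¬ TangentEmptyAt ℓ (M' j)) ∧
      (∀ N, ∃ r : ℝ, bev (M' j) (partialSum 2 N) r = 0) ∧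
      (∀ N (r : ℚ), bev (M' j) (partialSum 2 N) r = 0 → r.den ^ 5 ≤ 2 ^ (2 * N !)) ∧
      (∀ N (r : ℚ), bev (M' j) (partialSum 2 N) r = 0 → (r.den : ℝ) ^ (2 * N) < 2 ^ (N + 1)!) ∧
      (ThinFibreAt 2 (M' j) ↔ LevelFinite (M' j)) ∧
      SiegelClause (M' j) ∧ {N : ℕ | ∃ r : ℚ, bev (M' j) (partialSum 2 N) r = 0}.Finite ∧
      {r : ℚ | ∃ N : ℕ, bev (M' j) (partialSum 2 N) r = 0}.Finite ∧
      {p : ℚ × ℚ | IsDyadic p.1 ∧ bev (M' j) p.1 p.2 = 0}.Finite ∧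
      LevelFinite (M' j) ∧ BddLevelEmpty (M' j) ∧ (∀ m₀, ThinFibreAt m₀ (M' j)) :=
  M_territory _
/-- **`∀ j m₀, ThinFibreAt m₀ (M' j)`** and **`∀ j, LevelFinite (M' j)`** — the pinned subfamily, hypothesis-free. -/
theorem thinFibreAt_M' (j : ℤ) (m₀ : ℕ) : ThinFibreAt m₀ (M' j) := thinFibreAt_M _ m₀
/-- `(j : ℤ) : LevelFinite (M' j)`. -/
theorem levelFinite_M' (j : ℤ) : LevelFinite (M' j) := levelFinite_M _

end Territory

end Summit.Schanuel.Schanuel.Theorems.RootDecomp1KHyperellipticSiegel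

end
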